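import Summits.HodgeConjecture.HodgeConjecture.Theorems.Ring2HypothesesFlatSectionsQP
import Summits.HodgeConjecture.HodgeConjecture.Theorems.AnchorTransportVariationalHodgeQuasiProjective
import HarnessLib

/-!
# Ring 2 — binder seat b03 (Hodge ladder stage 3), junction for row b03: the printed-carrier node `VariationalHodgeQP` needs no
# quasi-projective BASE, and reaches the unrestricted crux `VariationalHodge` modulo exactly one named residual

HONEST FRAMING: research route conditional on HC_CM; not a corollary; Q11.4-sentence-2 already refuted in dim ≥ 3.

Cell `pub-hodge-ring2`, Hodge ladder stage 3, binder seat `ring2-b03` (row b03 of `BINDER-OWNERS.md`: the route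
item `Theses.AnchorTransport.VariationalHodge`, stmt-HodgeConjecture-1076 — Grothendieck's variational Hodge
conjecture in global-class form over ALL smooth irreducible bases; OPEN, nothing to discharge). `HC_CM` is not
mentioned in any statement below; nothing here is a case of the Hodge conjecture; no definition, no named fact,
no `sorry`. Every theorem is an implication between nodes ALREADY typed in the tree:

* typer2's part XXVII (`Ring2HypothesesFlatSectionsQP`) filed the PRINTED-CARRIER nodes `VariationalHodgeQP` /
  `FlatSectionsAlgebraicQP` (Charles–Schnell Conj. 11.3.1 verbatim carriers: `𝒳` AND `S` quasi-projective over
  `ℂ`), proved them equivalent with no fact binder, and recorded "no edge back to the unrestricted nodes is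
  claimed";
* the AnchorTransport route (`AnchorTransportVariationalHodgeReductions`, `…QuasiProjective`) proved that the crux
  reduces to smooth irreducible AFFINE bases (`variationalHodge_of_affine`), that over such a base a proper family
  with quasi-projective total space is projective in Hartshorne's sense and conversely
  (`variationalHodge_quasiProjective_of_projective`), and isolated the exact difference between the crux AS FILED
  (smooth PROPER families with projective fibres) and the printed conjecture (projective morphisms) as ONE
  predicate `hqp` — quasi-projectivity of the total space over affine bases, false in general (Atiyah 1958:
  mixed small resolutions of a two-nodal quartic pencil), `variationalHodge_of_projective_of_isQuasiProjectiveOver`.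

This junction composes the two (count once: the reductions are the AnchorTransport route's, the nodes typer2's):

* (J1) `variationalHodge_quasiProjective_of_variationalHodgeQP` — **`VariationalHodgeQP` already gives the
  global-class statement for quasi-projective TOTAL spaces over EVERY smooth irreducible base**: the hypothesis
  `IsQuasiProjectiveOver S` of XXVII's node is IDLE (an affine `ℂ`-scheme of finite type is quasi-projective,
  `IsQuasiProjectiveOver.of_isAffine`; a projective family over it has quasi-projective total space,
  `isQuasiProjectiveOver_of_isClosedImmersion_of_isAffine`).
* (J1′) `variationalHodgeQP_iff_quasiProjectiveTotal` — hence XXVII's node is EQUIVALENT to that statement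
  (the converse forgets the base clause).
* (J2) `variationalHodge_quasiProjective_of_flatSectionsAlgebraicQP` — the same from the flat-section node
  (XXVII `flatSectionsAlgebraicQP_iff_variationalHodgeQP`).
* (J3) `vhc_of_variationalHodgeQP_of_isQuasiProjectiveOver`, `vhc_of_flatSectionsAlgebraicQP_of_isQuasiProjectiveOver`
  — **granted the AnchorTransport residual `hqp`, the printed-carrier nodes give the crux AS FILED** (item 1076):
  row b03 is its printed-carrier class plus exactly that named residual, and nothing else.
* (J4) `vhc_iff_variationalHodgeQP_of_isQuasiProjectiveOver`, `vhc_iff_flatSectionsAlgebraicQP_of_isQuasiProjectiveOver`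
  — the exactness form: modulo `hqp`, `VariationalHodge ↔ VariationalHodgeQP ↔ FlatSectionsAlgebraicQP`.

What is NOT claimed: `hqp` (it is false as a blanket statement); any edge to the unrestricted flat-section node
`FlatSectionsAlgebraic` of part I (row b04: flat sections of the espace étalé over a non-quasi-projective base are
outside Deligne 1968 as discharged — that row's own residual); anything about `HC_AV` or `HC_CM` (the rows of these
nodes are XXVII §5 and part I §1d, unchanged).

References: [CharlesSchnell2014Notes] Conj. 11.3.1 (= arXiv:1101.3647 Conj. 30), Prop. 11.3.5; [Grothendieck1966]
footnote 13; [Hartshorne1977] II §4 (projective and quasi-projective morphisms), II Cor. 4.8 (e); [StacksProject]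
Tag 04XV, Tag 0F41; [Atiyah1958] (the small-resolution example, through the AnchorTransport docstrings).
-/

-- every declaration of this problem lives in `Summit.HodgeConjecture.HodgeConjecture.…` (summit = sub-problem);
-- namespace `…Ring2.Binders` = the binder seats of the cell's Hodge-ladder stage 3 (`BINDER-OWNERS.md`)
set_option linter.dupNamespace false

noncomputable section

open CategoryTheory AlgebraicGeometry MonoidalCategory
open Literature.AlgebraicGeometry Literature.AlgebraicGeometry.Motives
open Literature.AlgebraicGeometry.HodgeTheory

namespace Summit.HodgeConjecture.HodgeConjecture.Ring2.Binders

open Summit.HodgeConjecture.HodgeConjecture.Ring2.Hypotheses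

/-! ## §1 The base clause of `VariationalHodgeQP` is idle -/

/-- **(J1) `VariationalHodgeQP` gives the global-class variational Hodge statement for QUASI-PROJECTIVE TOTAL
SPACES over EVERY smooth irreducible base** (no quasi-projectivity, separatedness or quasi-compactness of the
base). Reduce to smooth irreducible AFFINE bases with quasi-projectivity of the total space carried along
(`Theorems.variationalHodge_quasiProjective_of_projective`: over an affine base a proper family with
quasi-projective total space is projective in Hartshorne's sense, and conversely a projective family has
quasi-projective total space, `Theorems.isQuasiProjectiveOver_of_isClosedImmersion_of_isAffine`); there the base is
affine of finite type over `ℂ` (smooth), hence quasi-projective (`IsQuasiProjectiveOver.of_isAffine`), so XXVII's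
node applies. [cite: Hartshorne1977, Ch. II §4 p. 103 (projective, quasi-projective morphisms) and Cor. 4.8 (e)]
[cite: CharlesSchnell2014Notes, Conj. 11.3.1] -/
theorem variationalHodge_quasiProjective_of_variationalHodgeQP (hV : VariationalHodgeQP)
    ⦃n : ℕ⦄ ⦃𝒳 S : SchemeOver ℂ⦄ (f : 𝒳 ⟶ S) (hf : IsSmoothProjectiveFamily f n)
    (h𝒳 : IsQuasiProjectiveOver 𝒳) (hirr : IrreducibleSpace S.left) (hsm : AlgebraicGeometry.Smooth S.hom)
    (p : ℕ) (A : complexBetti 𝒳 (2 * p))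
    (hA : ∀ s : ComplexPoints S, IsRationalClass (complexBetti.map (fiberι f s) (2 * p) A) ∧
      IsOfHodgeType n (fiberOver f s) (2 * p) p p (complexBetti.map (fiberι f s) (2 * p) A))
    (hs₀ : ∃ s₀ : ComplexPoints S, complexBetti.map (fiberι f s₀) (2 * p) A ∈ algebraicClasses (fiberOver f s₀) p)
    (s : ComplexPoints S) :
    complexBetti.map (fiberι f s) (2 * p) A ∈ algebraicClasses (fiberOver f s) p :=
  Theorems.variationalHodge_quasiProjective_of_projective
    (fun _ _ S' f' hf' hι hirr' haff hsm' p' A' hA' hs₀' s' => by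
      haveI := haff
      haveI := hsm'
      haveI : LocallyOfFiniteType S'.hom := inferInstance
      exact hV f' hf' (Theorems.isQuasiProjectiveOver_of_isClosedImmersion_of_isAffine hι)
        (IsQuasiProjectiveOver.of_isAffine S') hirr' hsm' p' A' hA' hs₀' s')
    f hf h𝒳 hirr hsm p A hA hs₀ s

/-- **(J1′) XXVII's printed-carrier node IS the statement for quasi-projective total spaces over arbitrary smooth
irreducible bases** (`↔`; the converse direction forgets the base clause). [cite: CharlesSchnell2014Notes, Conj. 11.3.1] -/
theorem variationalHodgeQP_iff_quasiProjectiveTotal :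
    VariationalHodgeQP ↔
      ∀ ⦃n : ℕ⦄ ⦃𝒳 S : SchemeOver ℂ⦄ (f : 𝒳 ⟶ S), IsSmoothProjectiveFamily f n →
        IsQuasiProjectiveOver 𝒳 → IrreducibleSpace S.left → AlgebraicGeometry.Smooth S.hom →
        ∀ (p : ℕ) (A : complexBetti 𝒳 (2 * p)),
          (∀ s : ComplexPoints S, IsRationalClass (complexBetti.map (fiberι f s) (2 * p) A) ∧
            IsOfHodgeType n (fiberOver f s) (2 * p) p p (complexBetti.map (fiberι f s) (2 * p) A)) →
          (∃ s₀ : ComplexPoints S,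
            complexBetti.map (fiberι f s₀) (2 * p) A ∈ algebraicClasses (fiberOver f s₀) p) →
          ∀ s : ComplexPoints S, complexBetti.map (fiberι f s) (2 * p) A ∈ algebraicClasses (fiberOver f s) p :=
  ⟨fun hV _ _ _ f hf h𝒳 hirr hsm p A hA hs₀ s =>
      variationalHodge_quasiProjective_of_variationalHodgeQP hV f hf h𝒳 hirr hsm p A hA hs₀ s,
    fun h _ _ _ f hf h𝒳 _ hirr hsm p A hA hs₀ s => h f hf h𝒳 hirr hsm p A hA hs₀ s⟩

/-- **(J2) The flat-section node on printed carriers (Conj. 11.3.1 verbatim) gives the global-class statement for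
quasi-projective total spaces over every smooth irreducible base** ((J1) after XXVII's
`flatSectionsAlgebraicQP_iff_variationalHodgeQP`). [cite: CharlesSchnell2014Notes, Conj. 11.3.1 and proof of Prop. 11.3.5] -/
theorem variationalHodge_quasiProjective_of_flatSectionsAlgebraicQP (hF : FlatSectionsAlgebraicQP)
    ⦃n : ℕ⦄ ⦃𝒳 S : SchemeOver ℂ⦄ (f : 𝒳 ⟶ S) (hf : IsSmoothProjectiveFamily f n)
    (h𝒳 : IsQuasiProjectiveOver 𝒳) (hirr : IrreducibleSpace S.left) (hsm : AlgebraicGeometry.Smooth S.hom)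
    (p : ℕ) (A : complexBetti 𝒳 (2 * p))
    (hA : ∀ s : ComplexPoints S, IsRationalClass (complexBetti.map (fiberι f s) (2 * p) A) ∧
      IsOfHodgeType n (fiberOver f s) (2 * p) p p (complexBetti.map (fiberι f s) (2 * p) A))
    (hs₀ : ∃ s₀ : ComplexPoints S, complexBetti.map (fiberι f s₀) (2 * p) A ∈ algebraicClasses (fiberOver f s₀) p)
    (s : ComplexPoints S) :
    complexBetti.map (fiberι f s) (2 * p) A ∈ algebraicClasses (fiberOver f s) p :=
  variationalHodge_quasiProjective_of_variationalHodgeQP (variationalHodgeQP_of_flatSectionsAlgebraicQP hF)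
    f hf h𝒳 hirr hsm p A hA hs₀ s

/-! ## §2 Back to the unrestricted crux (row b03), modulo the one named residual -/

/-- **(J3) `VariationalHodgeQP ⟹ VariationalHodge` (item 1076, AS FILED) granted the AnchorTransport residual
`hqp`** — total spaces of smooth proper families with smooth projective fibres over smooth irreducible AFFINE
bases are quasi-projective (false in general: Atiyah-flop families; the exact difference between the decl and
Grothendieck's conjecture, `Theorems.variationalHodge_of_projective_of_isQuasiProjectiveOver`). So row b03 is its
printed-carrier node plus `hqp`, nothing else. [cite: Grothendieck1966, footnote 13] [cite: CharlesSchnell2014Notes, Conj. 11.3.1] -/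
theorem vhc_of_variationalHodgeQP_of_isQuasiProjectiveOver
    (hqp : ∀ ⦃n : ℕ⦄ ⦃𝒳 S : SchemeOver ℂ⦄ (f : 𝒳 ⟶ S), IsSmoothProjectiveFamily f n →
      IrreducibleSpace S.left → IsAffine S.left → AlgebraicGeometry.Smooth S.hom → IsQuasiProjectiveOver 𝒳)
    (hV : VariationalHodgeQP) : Theses.AnchorTransport.VariationalHodge :=
  Theorems.variationalHodge_of_affine fun _ _ _ f hf hirr haff hsm p A hA hs₀ s =>
    variationalHodge_quasiProjective_of_variationalHodgeQP hV f hf (hqp f hf hirr haff hsm) hirr hsm p A hA hs₀ s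

/-- **(J3, flat-section form) `FlatSectionsAlgebraicQP ⟹ VariationalHodge` granted `hqp`**: Charles–Schnell's
Conj. 11.3.1 on its printed carriers reaches the tree's unrestricted global-class crux modulo the one residual.
[cite: CharlesSchnell2014Notes, Conj. 11.3.1 and proof of Prop. 11.3.5] -/
theorem vhc_of_flatSectionsAlgebraicQP_of_isQuasiProjectiveOver
    (hqp : ∀ ⦃n : ℕ⦄ ⦃𝒳 S : SchemeOver ℂ⦄ (f : 𝒳 ⟶ S), IsSmoothProjectiveFamily f n →
      IrreducibleSpace S.left → IsAffine S.left → AlgebraicGeometry.Smooth S.hom → IsQuasiProjectiveOver 𝒳)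
    (hF : FlatSectionsAlgebraicQP) : Theses.AnchorTransport.VariationalHodge :=
  vhc_of_variationalHodgeQP_of_isQuasiProjectiveOver hqp (variationalHodgeQP_of_flatSectionsAlgebraicQP hF)

/-- **(J4) Exactness of row b03 against its printed-carrier node**: granted `hqp`,
`VariationalHodge ↔ VariationalHodgeQP` (`→` is XXVII's restriction `variationalHodgeQP_of_vhc`).
[cite: CharlesSchnell2014Notes, Conj. 11.3.1] -/
theorem vhc_iff_variationalHodgeQP_of_isQuasiProjectiveOver
    (hqp : ∀ ⦃n : ℕ⦄ ⦃𝒳 S : SchemeOver ℂ⦄ (f : 𝒳 ⟶ S), IsSmoothProjectiveFamily f n →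
      IrreducibleSpace S.left → IsAffine S.left → AlgebraicGeometry.Smooth S.hom → IsQuasiProjectiveOver 𝒳) :
    Theses.AnchorTransport.VariationalHodge ↔ VariationalHodgeQP :=
  ⟨variationalHodgeQP_of_vhc, vhc_of_variationalHodgeQP_of_isQuasiProjectiveOver hqp⟩

/-- **(J4, flat-section form)**: granted `hqp`, `VariationalHodge ↔ FlatSectionsAlgebraicQP` — the tree's
global-class crux over all smooth irreducible bases and Charles–Schnell's Conj. 11.3.1 on its printed carriers are
one node modulo the Atiyah-flop residual. [cite: CharlesSchnell2014Notes, Conj. 11.3.1, Thm. 11.3.4 and Prop. 11.3.5] -/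
theorem vhc_iff_flatSectionsAlgebraicQP_of_isQuasiProjectiveOver
    (hqp : ∀ ⦃n : ℕ⦄ ⦃𝒳 S : SchemeOver ℂ⦄ (f : 𝒳 ⟶ S), IsSmoothProjectiveFamily f n →
      IrreducibleSpace S.left → IsAffine S.left → AlgebraicGeometry.Smooth S.hom → IsQuasiProjectiveOver 𝒳) :
    Theses.AnchorTransport.VariationalHodge ↔ FlatSectionsAlgebraicQP :=
  ⟨flatSectionsAlgebraicQP_of_vhc, vhc_of_flatSectionsAlgebraicQP_of_isQuasiProjectiveOver hqp⟩

/-! ## Audit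

No named fact, no `HC_CM`, no definition: (J1)–(J2) are unconditional kernel theorems; (J3)–(J4) carry the
residual `hqp` as an explicit hypothesis (NOT a theorem — false for Atiyah-flop families). Axiom closures: the
three standard axioms only. -/

#print axioms Summit.HodgeConjecture.HodgeConjecture.Ring2.Binders.variationalHodge_quasiProjective_of_variationalHodgeQP
#print axioms Summit.HodgeConjecture.HodgeConjecture.Ring2.Binders.variationalHodgeQP_iff_quasiProjectiveTotal
#print axioms Summit.HodgeConjecture.HodgeConjecture.Ring2.Binders.vhc_iff_flatSectionsAlgebraicQP_of_isQuasiProjectiveOver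

end Summit.HodgeConjecture.HodgeConjecture.Ring2.Binders

end
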